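import Summits.Ventures.HSemireg.WedgeHankelClassSpaceShearExponential
import Summits.Ventures.HSemireg.WedgeHankelClassSpaceWeylElement

/-!
# Venture HSemireg — THE LOWER SHEAR IS THE EXPONENTIAL OF THE LOWERING OPERATOR: `SbC(1 0 c 1) = Σ_{k ≤ n} (c^k / k!) • f^k` on th-7's classes when `n!` is a unit
# (`L(c) = S·U(c)·S` and `S·e^k·S = f^k`), so the lower shear commutes with `f`; with K28 both root subgroups of `SL₂` are exponentials of the nilpotent generators

HONEST FRAMING. Part of the Lean index of the computation cell `pub-hsemireg` (seat p10 gen 22, Sunday typer «UNIFORM-IN-n»).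
Finite-dimensional EXTERIOR ALGEBRA + linear algebra ONLY: no variety, no cohomology theory, no sheaf, no Ext group, no semiregularity map;
nothing here says that HC / HC_CM / HC_AV holds; no Literature fact is declared or used.  Custodian versions as in `WedgeHankelSiegelIdeal` (1/3) and `WedgeHankelFrameChange`;
the dictionary (`(1 0; c 1) = exp(c E₂₁)` on `Sym^n`) is QUOTED, never asserted.

WHAT IS IN THE TREE.  K28 (`WedgeHankelClassSpaceShearExponential`): `SbC_shear_eq_sum_pow_raising` (`SbC(1 λ 0 1) = Σ (λ^k/k!) • e^k`); K30 (`WedgeHankelClassSpaceWeylElement`):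
`swap_mul_raising_mul_swap` (`S·e·S = f`); J11 `SbC_lower_shear_eq_swap_conj` (`SbC(1 0 c 1) = S·SbC(1 c 0 1)·S`), `SbC_swap_mul_swap` (`S² = 1`).  THIS FILE (namespace
`Summit.Ventures.HSemireg.Wedge.HankelFrameChange` continued; imports K28, K30):
* §340 `swap_mul_pow_raising_mul_swap` (`S·e^k·S = f^k`), `swap_mul_sum_mul_swap` (conjugating a `K`-linear combination of powers), **`SbC_lower_shear_eq_sum_pow_lowering`:
  `SbC(1 0 c 1) = Σ_{k ≤ n} (c^k / k!) • f^k`** (`k!` units for `k ≤ n`), `…_charZero`, **`commute_SbC_lower_shear_lowering`** (`SbC(1 0 c 1)·f = f·SbC(1 0 c 1)`).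
NOT typed here: characteristic `p ≤ n`; the full `SL₂` as generated by the two exponentials (K24 is the group-level statement); anything Ext-side.  New names only.
-/

open Module

namespace Summit.Ventures.HSemireg.Wedge.HankelFrameChange

open Summit.Ventures.HSemireg.Wedge Summit.Ventures.HSemireg.Wedge.Kunneth Summit.Ventures.HSemireg.Wedge.Hankel
  Summit.Ventures.HSemireg.Wedge.BasisFree Summit.Ventures.HSemireg.Wedge.HankelSiegel Summit.Ventures.HSemireg.Wedge.HankelSiegelIdeal
  Summit.Ventures.HSemireg.Wedge.KunnethKernel Summit.Ventures.HSemireg.Wedge.HankelRankOne Summit.Ventures.HSemireg.Wedge.KernelDuality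

variable (K : Type*) [Field K] {n : ℕ}

/-! ## §340. Conjugating the exponential by the Weyl element -/

section LowerExp

variable {e f : Module.End K (spikeSpan K n)}
  (hE : ∀ (i : Fin (n + 1)) (hi : (i : ℕ) < n), e (spikeBasis K n i) = (((i : ℕ) : K) + 1) • spikeBasis K n ⟨(i : ℕ) + 1, by omega⟩) (hEtop : e (spikeBasis K n (Fin.last n)) = 0)
  (hF : ∀ (i : Fin (n + 1)) (hi : 0 < (i : ℕ)), f (spikeBasis K n i) = ((n : K) - (i : ℕ) + 1) • spikeBasis K n ⟨(i : ℕ) - 1, by omega⟩) (hF0 : f (spikeBasis K n 0) = 0)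
include hE hEtop hF hF0

/-- **`S·e^k·S = f^k`** (`S·e·S = f`, `S² = 1`). -/
theorem swap_mul_pow_raising_mul_swap (k : ℕ) : SbC K 0 1 1 0 * e ^ k * SbC K 0 1 1 0 = f ^ k := by
  induction k with
  | zero => rw [pow_zero, mul_one, SbC_swap_mul_swap, pow_zero]
  | succ k ih =>
    rw [pow_succ, pow_succ, ← ih, ← swap_mul_raising_mul_swap K hE hEtop hF hF0]
    -- `S e^k e S = (S e^k S)(S e S)` since `S S = 1`
    simp only [mul_assoc]
    rw [← mul_assoc (SbC K 0 1 1 0) (SbC K 0 1 1 0) (e * SbC K 0 1 1 0), SbC_swap_mul_swap, one_mul]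

/-- conjugating a linear combination of powers of `e` by `S` gives the same combination of powers of `f`. -/
theorem swap_mul_sum_mul_swap (c : Fin (n + 1) → K) :
    SbC K 0 1 1 0 * (∑ k : Fin (n + 1), c k • e ^ (k : ℕ)) * SbC K 0 1 1 0 = ∑ k : Fin (n + 1), c k • f ^ (k : ℕ) := by
  rw [Finset.mul_sum, Finset.sum_mul]
  exact Finset.sum_congr rfl fun k _ => by rw [mul_smul_comm, smul_mul_assoc, swap_mul_pow_raising_mul_swap K hE hEtop hF hF0]

/-- **THE LOWER SHEAR IS THE EXPONENTIAL OF THE LOWERING OPERATOR: `SbC(1 0 c 1) = Σ_{k ≤ n} (c^k / k!) • f^k`** (`k!` a unit in `K` for `k ≤ n`): `L(c) = S·U(c)·S` (J11) and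
`S·exp(c e)·S = exp(c f)`. -/
theorem SbC_lower_shear_eq_sum_pow_lowering (hfac : ∀ k ≤ n, ((k.factorial : ℕ) : K) ≠ 0) (c : K) :
    SbC K 1 0 c 1 = ∑ k : Fin (n + 1), (c ^ (k : ℕ) / ((k : ℕ).factorial : K)) • f ^ (k : ℕ) := by
  rw [SbC_lower_shear_eq_swap_conj, SbC_shear_eq_sum_pow_raising K hE hEtop hfac c, swap_mul_sum_mul_swap K hE hEtop hF hF0]

/-- characteristic `0`: `SbC(1 0 c 1) = Σ_{k ≤ n} (c^k / k!) • f^k`. -/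
theorem SbC_lower_shear_eq_sum_pow_lowering_charZero [CharZero K] (c : K) :
    SbC K 1 0 c 1 = ∑ k : Fin (n + 1), (c ^ (k : ℕ) / ((k : ℕ).factorial : K)) • f ^ (k : ℕ) :=
  SbC_lower_shear_eq_sum_pow_lowering K hE hEtop hF hF0 (fun k _ => Nat.cast_ne_zero.mpr (Nat.factorial_ne_zero k)) c

/-- **the lower shear commutes with the lowering operator** (`n!` a unit). -/
theorem commute_SbC_lower_shear_lowering (hfac : ∀ k ≤ n, ((k.factorial : ℕ) : K) ≠ 0) (c : K) : SbC K 1 0 c 1 * f = f * SbC K 1 0 c 1 := by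
  rw [SbC_lower_shear_eq_sum_pow_lowering K hE hEtop hF hF0 hfac c, Finset.sum_mul, Finset.mul_sum]
  exact Finset.sum_congr rfl fun k _ => by rw [smul_mul_assoc, mul_smul_comm, ← pow_succ, ← pow_succ']

end LowerExp

end Summit.Ventures.HSemireg.Wedge.HankelFrameChange
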